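import Summits.CriticalPhenomena.PercolationContinuityZ3.Theorems.PercNearOneGluingNoHeavyLowerTailThreePointIsoSexticPendantNonPort
import Summits.CriticalPhenomena.PercolationContinuityZ3.Theorems.PercNearOneGluingNoHeavyLowerTailThreePointIsoSexticPendant
import HarnessLib

/-!
# The full sextic isolation SYSTEM `(Q6)` is preserved by pendant/arm extension of the port and by parallel composition — law level

Support file for crux `stmt-CriticalPhenomena-4575` (`NoHeavyLowerTail`), seat `prim-facecert` gen 19 (`--supports stmt-CriticalPhenomena-4575`).
Lead memos `run/shared/lean/prim/prim-l12/FROM-prim-nh-lead-4575-g115-Q6-LAW-ALGEBRA.md` §5–6, `…-g117-NONPORT-Q6.md` (Lemma A).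

Law of `(a,b;h)`: `x,s,t,u,q ≥ 0`, sum `1`; `Q = q`, `I_a = q+u`, `I_b = q+t`, `I_h = q+s`, `z = q+t+u = P(a≁b)`.  The `(Q6)` SYSTEM:
`Q⁶ ≤ I_a²I_b³I_h³ ∧ Q⁶ ≤ I_a³I_b²I_h³ ∧ Q⁶ ≤ I_a³I_b³I_h²` (`⟺ Q⁶·max(I_a,I_b,I_h) ≤ (I_aI_bI_h)³`).  Arm/pendant extension of the port with
connection probability `α ∈ [0,1]`: `Q' = αq+(1−α)z`, `I_a' = α(q+u)+(1−α)z`, `I_b' = α(q+t)+(1−α)z`, `I_w' = α(q+s)+1−α`.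
* `isoSexticA_pendant`: **`q⁶ ≤ (q+u)²(q+t)³(q+s)³ ⟹ Q'⁶ ≤ I_a'²·I_b'³·I_w'³`** — each non-port component is preserved from ITS OWN hypothesis
  (for laws; via `ThreePointIsoSexticPendantNonPort.lemmaA_log` with `λ = log z`); `isoSexticB_pendant` (`t ↔ u`).
* `isoSexticSystem_pendant`: the whole system (port component from `ThreePointIsoSexticPendant.isoSexticPort_pendant`).
* `isoSextic233_prod`: products (parallel composition at the three terminals, fans = products of pendant-extended rays) preserve every monomial
  component (`(2,3,3)` here; `(3,3,2)` is `ThreePointIsoSexticPendant.isoSexticPort_prod`).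
Hence the FULL `(Q6)` system holds on the whole {parallel₃, pendant/arm, fan}-closure of the laws satisfying it (all towers, fans of fans).
-/

namespace Summit.CriticalPhenomena.PercolationContinuityZ3.Theorems.ThreePointIsoSexticPendantSystem

open Real
open Summit.CriticalPhenomena.PercolationContinuityZ3.Theorems.ThreePointIsoSexticPendantNonPort

/-- Log bookkeeping for the law coordinates: with `z = q+t+u > 0`, `A' = α(q+u)+(1−α)z`, `B' = α(q+t)+(1−α)z`, `H' = α(q+s)+1−α`,
`Q' = αq+(1−α)z` (`z, A', B', Q'` positive) and `x+s+t+u+q = 1`: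
`2log(1−α·t/z) + 3log(1−α·u/z) + 3log(1−α(x+t+u)) − 6log(1−α(t/z+u/z)) = 2log A' + 3log B' + 3log H' − 6log Q' + log z`. [this work] -/
theorem law_logE {x s t u q α : ℝ} (hsum : x + s + t + u + q = 1) (hz : 0 < q + t + u)
    (hA : 0 < α * (q + u) + (1 - α) * (q + t + u)) (hB : 0 < α * (q + t) + (1 - α) * (q + t + u))
    (hQ : 0 < α * q + (1 - α) * (q + t + u)) :
    2 * Real.log (1 - α * (t / (q + t + u))) + 3 * Real.log (1 - α * (u / (q + t + u))) +
        3 * Real.log (1 - α * (x + t + u)) - 6 * Real.log (1 - α * (t / (q + t + u) + u / (q + t + u))) =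
      2 * Real.log (α * (q + u) + (1 - α) * (q + t + u)) + 3 * Real.log (α * (q + t) + (1 - α) * (q + t + u)) +
        3 * Real.log (α * (q + s) + (1 - α)) - 6 * Real.log (α * q + (1 - α) * (q + t + u)) + Real.log (q + t + u) := by
  have hzne : q + t + u ≠ 0 := ne_of_gt hz
  have e1 : 1 - α * (t / (q + t + u)) = (α * (q + u) + (1 - α) * (q + t + u)) / (q + t + u) := by field_simp; ring
  have e2 : 1 - α * (u / (q + t + u)) = (α * (q + t) + (1 - α) * (q + t + u)) / (q + t + u) := by field_simp; ring
  have e3 : 1 - α * (x + t + u) = α * (q + s) + (1 - α) := by linear_combination (-α) * hsum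
  have e4 : 1 - α * (t / (q + t + u) + u / (q + t + u)) = (α * q + (1 - α) * (q + t + u)) / (q + t + u) := by
    field_simp; ring
  rw [e1, e2, e3, e4, Real.log_div hA.ne' hzne, Real.log_div hB.ne' hzne, Real.log_div hQ.ne' hzne]
  ring

/-- **The `I_a`-component of `(Q6)` is preserved by arm/pendant extension of the port** (lead g117 Lemma A, for laws):
`x,s,t,u,q ≥ 0`, `x+s+t+u+q = 1`, `α ∈ [0,1]`, `q⁶ ≤ (q+u)²(q+t)³(q+s)³ ⟹ Q'⁶ ≤ I_a'²·I_b'³·I_w'³` with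
`Q' = αq+(1−α)z`, `I_a' = α(q+u)+(1−α)z`, `I_b' = α(q+t)+(1−α)z`, `I_w' = α(q+s)+1−α`, `z = q+t+u`. [this work] -/
theorem isoSexticA_pendant {x s t u q α : ℝ} (hx : 0 ≤ x) (hs : 0 ≤ s) (ht : 0 ≤ t) (hu : 0 ≤ u) (hq : 0 ≤ q)
    (hsum : x + s + t + u + q = 1) (hα0 : 0 ≤ α) (hα1 : α ≤ 1)
    (hAcomp : q ^ 6 ≤ (q + u) ^ 2 * (q + t) ^ 3 * (q + s) ^ 3) :
    (α * q + (1 - α) * (q + t + u)) ^ 6 ≤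
      (α * (q + u) + (1 - α) * (q + t + u)) ^ 2 * (α * (q + t) + (1 - α) * (q + t + u)) ^ 3 *
        (α * (q + s) + (1 - α)) ^ 3 := by
  have hz0 : 0 ≤ q + t + u := by positivity
  have h1α : 0 ≤ 1 - α := by linarith
  rcases eq_or_lt_of_le hz0 with hz | hz
  · have hq0 : q = 0 := by linarith
    have ht0 : t = 0 := by linarith
    have hu0 : u = 0 := by linarith
    rw [hq0, ht0, hu0]; norm_num
  have hz1 : q + t + u ≤ 1 := by linarith
  rcases eq_or_lt_of_le hq with hq0 | hqpos
  · -- `q = 0`: `A'B' ≥ (1−α)z²`, `B' ≥ (1−α)z`, `H' ≥ 1−α`, `z ≤ 1`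
    rw [← hq0]
    simp only [zero_add, mul_zero]
    have hAB : (1 - α) * (t + u) ^ 2 ≤ (α * u + (1 - α) * (t + u)) * (α * t + (1 - α) * (t + u)) := by
      nlinarith [mul_nonneg (mul_nonneg hα0 hα0) (mul_nonneg ht hu)]
    have hB : (1 - α) * (t + u) ≤ α * t + (1 - α) * (t + u) := by nlinarith
    have hH : 1 - α ≤ α * s + (1 - α) := by nlinarith
    have hzz : 0 ≤ t + u := by positivity
    have hz1' : t + u ≤ 1 := by linarith
    have h0 : 0 ≤ (1 - α) * (t + u) := mul_nonneg h1α hzz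
    calc ((1 - α) * (t + u)) ^ 6 = ((1 - α) * (t + u)) ^ 5 * ((1 - α) * (t + u)) := by ring
      _ ≤ ((1 - α) * (t + u)) ^ 5 * ((1 - α) * 1) := by
          apply mul_le_mul_of_nonneg_left _ (pow_nonneg h0 5)
          exact mul_le_mul_of_nonneg_left hz1' h1α
      _ = ((1 - α) * (t + u) ^ 2) ^ 2 * ((1 - α) * (t + u)) * (1 - α) ^ 3 := by ring
      _ ≤ ((α * u + (1 - α) * (t + u)) * (α * t + (1 - α) * (t + u))) ^ 2 * (α * t + (1 - α) * (t + u)) *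
            (α * s + (1 - α)) ^ 3 := by
          apply mul_le_mul (mul_le_mul (pow_le_pow_left₀ (by positivity) hAB 2) hB h0 (by positivity))
            (pow_le_pow_left₀ h1α hH 3) (by positivity)
          exact mul_nonneg (by positivity) (h0.trans hB)
      _ = (α * u + (1 - α) * (t + u)) ^ 2 * (α * t + (1 - α) * (t + u)) ^ 3 * (α * s + (1 - α)) ^ 3 := by ring
  -- main case `q > 0`: normalised coordinates and LEMMA A
  have hQ' : 0 < α * q + (1 - α) * (q + t + u) := by nlinarith
  have hA' : 0 < α * (q + u) + (1 - α) * (q + t + u) := by nlinarith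
  have hB' : 0 < α * (q + t) + (1 - α) * (q + t + u) := by nlinarith
  have hH' : 0 < α * (q + s) + (1 - α) := by nlinarith
  have hzne : q + t + u ≠ 0 := ne_of_gt hz
  -- hypotheses of `lemmaA_log`
  have ha : 0 ≤ t / (q + t + u) := div_nonneg ht hz0
  have hb : 0 ≤ u / (q + t + u) := div_nonneg hu hz0
  have hd : t / (q + t + u) + u / (q + t + u) < 1 := by
    rw [← add_div, div_lt_one hz]; linarith
  have hc : 0 ≤ x + t + u := by positivity
  have hc1 : x + t + u < 1 := by linarith
  have hl0 : Real.log (q + t + u) ≤ 0 := Real.log_nonpos hz0 hz1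
  have hlM : Real.log (q + t + u) ≤ Real.log (1 - (x + t + u)) - Real.log (1 - (t / (q + t + u) + u / (q + t + u))) := by
    have e3 : 1 - (x + t + u) = q + s := by linear_combination (-1 : ℝ) * hsum
    have e4 : 1 - (t / (q + t + u) + u / (q + t + u)) = q / (q + t + u) := by field_simp; ring
    rw [e3, e4, Real.log_div hqpos.ne' hzne]
    have := Real.log_le_log hqpos (show q ≤ q + s by linarith)
    linarith
  -- the hypothesis at `α = 1`
  have key1 := law_logE (α := 1) hsum hz (by linarith) (by linarith) (by linarith)
  have hl1 : Real.log (q + t + u) ≤ 2 * Real.log (1 - 1 * (t / (q + t + u))) + 3 * Real.log (1 - 1 * (u / (q + t + u))) +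
      3 * Real.log (1 - 1 * (x + t + u)) - 6 * Real.log (1 - 1 * (t / (q + t + u) + u / (q + t + u))) := by
    rw [key1]
    have hlog := Real.log_le_log (pow_pos hqpos 6) hAcomp
    have hqu : 0 < q + u := by linarith
    have hqt : 0 < q + t := by linarith
    have hqs : 0 < q + s := by linarith
    rw [Real.log_mul (mul_ne_zero (pow_ne_zero _ hqu.ne') (pow_ne_zero _ hqt.ne')) (pow_ne_zero _ hqs.ne'),
      Real.log_mul (pow_ne_zero _ hqu.ne') (pow_ne_zero _ hqt.ne'), Real.log_pow, Real.log_pow, Real.log_pow,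
      Real.log_pow] at hlog
    push_cast at hlog
    norm_num
    linarith
  have main := lemmaA_log (lam := Real.log (q + t + u)) ha hb hc hd hc1 hα0 hα1 hl0 hlM hl1
  rw [law_logE hsum hz hA' hB' hQ'] at main
  -- back to the product inequality
  have hlog : Real.log ((α * q + (1 - α) * (q + t + u)) ^ 6) ≤
      Real.log ((α * (q + u) + (1 - α) * (q + t + u)) ^ 2 * (α * (q + t) + (1 - α) * (q + t + u)) ^ 3 *
        (α * (q + s) + (1 - α)) ^ 3) := by
    rw [Real.log_mul (mul_ne_zero (pow_ne_zero _ hA'.ne') (pow_ne_zero _ hB'.ne')) (pow_ne_zero _ hH'.ne'),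
      Real.log_mul (pow_ne_zero _ hA'.ne') (pow_ne_zero _ hB'.ne'), Real.log_pow, Real.log_pow, Real.log_pow, Real.log_pow]
    push_cast
    linarith
  exact (Real.log_le_log_iff (by positivity) (by positivity)).1 hlog

/-- **The `I_b`-component** (by the symmetry `t ↔ u`): `q⁶ ≤ (q+u)³(q+t)²(q+s)³ ⟹ Q'⁶ ≤ I_a'³·I_b'²·I_w'³`. [this work] -/
theorem isoSexticB_pendant {x s t u q α : ℝ} (hx : 0 ≤ x) (hs : 0 ≤ s) (ht : 0 ≤ t) (hu : 0 ≤ u) (hq : 0 ≤ q)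
    (hsum : x + s + t + u + q = 1) (hα0 : 0 ≤ α) (hα1 : α ≤ 1)
    (hBcomp : q ^ 6 ≤ (q + u) ^ 3 * (q + t) ^ 2 * (q + s) ^ 3) :
    (α * q + (1 - α) * (q + t + u)) ^ 6 ≤
      (α * (q + u) + (1 - α) * (q + t + u)) ^ 3 * (α * (q + t) + (1 - α) * (q + t + u)) ^ 2 *
        (α * (q + s) + (1 - α)) ^ 3 := by
  have h := isoSexticA_pendant (x := x) (s := s) (t := u) (u := t) (q := q) (α := α) hx hs hu ht hq (by linarith) hα0 hα1
    (by calc q ^ 6 ≤ (q + u) ^ 3 * (q + t) ^ 2 * (q + s) ^ 3 := hBcomp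
      _ = (q + t) ^ 2 * (q + u) ^ 3 * (q + s) ^ 3 := by ring)
  have e : q + u + t = q + t + u := by ring
  rw [e] at h
  calc (α * q + (1 - α) * (q + t + u)) ^ 6
      ≤ (α * (q + t) + (1 - α) * (q + t + u)) ^ 2 * (α * (q + u) + (1 - α) * (q + t + u)) ^ 3 *
          (α * (q + s) + (1 - α)) ^ 3 := h
    _ = _ := by ring

/-- **Products preserve every monomial component**: `Qᵢ ≥ 0`, `Qᵢ⁶ ≤ Aᵢ²Bᵢ³Wᵢ³` for `i ∈ S` ⟹ `(∏Qᵢ)⁶ ≤ (∏Aᵢ)²(∏Bᵢ)³(∏Wᵢ)³`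
(parallel composition at the three terminals; with `ThreePointIsoSexticPendant.isoSexticPort_prod` all three components). [this work] -/
theorem isoSextic233_prod {ι : Type*} (S : Finset ι) (Q A B W : ι → ℝ) (hQ : ∀ i ∈ S, 0 ≤ Q i)
    (h : ∀ i ∈ S, Q i ^ 6 ≤ A i ^ 2 * B i ^ 3 * W i ^ 3) :
    (∏ i ∈ S, Q i) ^ 6 ≤ (∏ i ∈ S, A i) ^ 2 * (∏ i ∈ S, B i) ^ 3 * (∏ i ∈ S, W i) ^ 3 := by
  rw [← Finset.prod_pow, ← Finset.prod_pow, ← Finset.prod_pow, ← Finset.prod_pow, ← Finset.prod_mul_distrib,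
    ← Finset.prod_mul_distrib]
  exact Finset.prod_le_prod (fun i hi => pow_nonneg (hQ i hi) 6) h

/-- **The full `(Q6)` SYSTEM is preserved by arm/pendant extension of the port** (all three components; the port component is
`ThreePointIsoSexticPendant.isoSexticPort_pendant`). [this work] -/
theorem isoSexticSystem_pendant {x s t u q α : ℝ} (hx : 0 ≤ x) (hs : 0 ≤ s) (ht : 0 ≤ t) (hu : 0 ≤ u) (hq : 0 ≤ q)
    (hsum : x + s + t + u + q = 1) (hα0 : 0 ≤ α) (hα1 : α ≤ 1)
    (hA : q ^ 6 ≤ (q + u) ^ 2 * (q + t) ^ 3 * (q + s) ^ 3) (hB : q ^ 6 ≤ (q + u) ^ 3 * (q + t) ^ 2 * (q + s) ^ 3)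
    (hP : q ^ 6 ≤ (q + u) ^ 3 * (q + t) ^ 3 * (q + s) ^ 2) :
    (α * q + (1 - α) * (q + t + u)) ^ 6 ≤
        (α * (q + u) + (1 - α) * (q + t + u)) ^ 2 * (α * (q + t) + (1 - α) * (q + t + u)) ^ 3 * (α * (q + s) + (1 - α)) ^ 3 ∧
      (α * q + (1 - α) * (q + t + u)) ^ 6 ≤
        (α * (q + u) + (1 - α) * (q + t + u)) ^ 3 * (α * (q + t) + (1 - α) * (q + t + u)) ^ 2 * (α * (q + s) + (1 - α)) ^ 3 ∧
      (α * q + (1 - α) * (q + t + u)) ^ 6 ≤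
        (α * (q + u) + (1 - α) * (q + t + u)) ^ 3 * (α * (q + t) + (1 - α) * (q + t + u)) ^ 3 * (α * (q + s) + (1 - α)) ^ 2 :=
  ⟨isoSexticA_pendant hx hs ht hu hq hsum hα0 hα1 hA, isoSexticB_pendant hx hs ht hu hq hsum hα0 hα1 hB,
    ThreePointIsoSexticPendant.isoSexticPort_pendant hx hs ht hu hq hsum hα0 hα1 hP⟩

end Summit.CriticalPhenomena.PercolationContinuityZ3.Theorems.ThreePointIsoSexticPendantSystem
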